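import Summits.AtomisticToContinuum.BoseEinsteinCondensation.Theses.BECStronglyRayleigh
import Summits.AtomisticToContinuum.BoseEinsteinCondensation.Theorems.InsertionFieldDelocalisation.Negative.Toolkit
import Summits.AtomisticToContinuum.BoseEinsteinCondensation.Theorems.InsertionFieldDelocalisation.Negative.PerronExistence
import Summits.AtomisticToContinuum.BoseEinsteinCondensation.Theorems.InsertionFieldDelocalisation.Negative.LoadBearing
import Summits.AtomisticToContinuum.BoseEinsteinCondensation.Theorems.BECStronglyRayleighGroundStateStabilityEulerGate
import Literature.MathematicalPhysics.QuantumLattice.LiebMattisLadder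
import Literature.MathematicalPhysics.QuantumLattice.LiebMattisSectorPF
import HarnessLib

/-!
# Stub `stub_embedding` (STUB 3) of line `mobile-trap-dirichlet-eigenfunction`, crux
# `BECStronglyRayleigh.InsertionFieldDelocalisation` (stmt-AtomisticToContinuum-9673)

**The two-body embedding of an eigenvector** of the hard-core Bose gas
`H = xyTorus 3 L 1 = xxzHamiltonian 1 (torusGraph 3 L) (-1) 0` (occupied = spin up = index `0`,
`1_S = fun z => if z ∈ S then 0 else 1`). For `Hψ = Eψ` and the one-particle insertion field
`u(T, x) := [x ∉ T] · Re ψ(1_{T ∪ x})` (background `T`, tagged particle at `x`):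

`-½ Σ_{t ∈ T} Σ_{b ∉ T, b ∼ t} u(T - t + b, x) - ½ Σ_{y ∼ x} u(T, y) - E · u(T, x) = -[x ∈ T] · Σ_{y ∼ x} u(T, y)`,

exactly, for all `T`, `x`, `E`, `ψ`.

Proof. (1) The occupation-basis action of the `Δ = 0` XXZ Hamiltonian on any finite graph
(`mt3em_xxzZero_mulVec_ind`): `(Hψ)(1_S) = (J/2) Σ_{a ∈ S} Σ_b [b ∉ S, a ∼ b] ψ(1_{S - a + b})`,
from the bond action `gate_xxzBond_mulVec_apply` (a bond exchanges the occupations of its two ends,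
amplitude `½`) and the darts-versus-edges bookkeeping `mt3em_sum_sum_ite_adj`.
(2) For `x ∉ T` the identity is the eigen-equation read at `S = T ∪ x`: moves of the tag give the
`Σ_{y ∼ x}` term, moves of a background particle `t ↦ b ≠ x` give the first term (the move `b = x`
is killed by `x ∈ insert b (T.erase t)`). For `x ∈ T`, `u(T, x) = 0`, only `t = x` survives in the
first term, which then equals the second.
-/

noncomputable section

namespace Summit.AtomisticToContinuum.BoseEinsteinCondensation.Cruxes.InsertionFieldDelocalisation.MobileTrapDirichletEigenfunction

open scoped BigOperators
open Literature.MathematicalPhysics.QuantumLattice Literature.Probability.LatticeModels Matrix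
open Summit.AtomisticToContinuum.BoseEinsteinCondensation.Cruxes.GroundStateStability.StableConeVariationalSelection
  (gate_xxzBond_mulVec_apply gate_swap_ind gate_ind_apply_eq_iff)

/-! ### Darts versus edges -/

/-- **Ordered adjacent pairs are the darts**: `Σ_x Σ_y [x ∼ y] f(x,y) = Σ_{e={x,y}} (f(x,y) + f(y,x))`
in any additive commutative monoid. [folklore] -/
theorem mt3em_sum_sum_ite_adj {V : Type*} [Fintype V] [DecidableEq V] (G : SimpleGraph V)
    [DecidableRel G.Adj] {M : Type*} [AddCommMonoid M] (f : V → V → M) :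
    ∑ x, ∑ y, (if G.Adj x y then f x y else 0) =
      ∑ e ∈ G.edgeFinset, Sym2.lift ⟨fun x y => f x y + f y x, fun _ _ => add_comm _ _⟩ e := by
  -- adapted from `Literature/Probability/LatticeModels/EffectiveResistanceProofs.lean`,
  -- `sum_sum_adj_eq_sum_edgeFinset` (real-valued there)
  set A := (Finset.univ ×ˢ Finset.univ : Finset (V × V)).filter (fun p => G.Adj p.1 p.2) with hA
  have hL : ∑ p ∈ A, f p.1 p.2 = ∑ x, ∑ y, (if G.Adj x y then f x y else 0) := by
    rw [hA, Finset.sum_filter, Finset.sum_product]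
  have hmaps : ∀ p ∈ A, s(p.1, p.2) ∈ G.edgeFinset := fun p hp => by
    rw [SimpleGraph.mem_edgeFinset]
    exact (Finset.mem_filter.1 hp).2
  rw [← hL, ← Finset.sum_fiberwise_of_maps_to hmaps]
  refine Finset.sum_congr rfl fun e he => ?_
  induction e using Sym2.ind with
  | h a b =>
    have hab : G.Adj a b := by simpa using he
    have hfib : A.filter (fun p => s(p.1, p.2) = s(a, b)) = {(a, b), (b, a)} := by
      ext ⟨p, q⟩
      simp only [hA, Finset.mem_filter, Finset.mem_product, Finset.mem_univ, true_and,
        Finset.mem_insert, Finset.mem_singleton, Prod.mk.injEq]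
      constructor
      · rintro ⟨-, h⟩
        exact Sym2.eq_iff.1 h
      · rintro (⟨rfl, rfl⟩ | ⟨rfl, rfl⟩)
        · exact ⟨hab, rfl⟩
        · exact ⟨hab.symm, Sym2.eq_swap⟩
    have hne : (a, b) ≠ (b, a) := fun h => hab.ne (Prod.mk.inj h).1
    rw [hfib, Finset.sum_pair hne]
    rfl

/-- **Hops out of a set as an edge sum**:
`Σ_{a ∈ S} Σ_b [b ∉ S, a ∼ b] g(a,b) = Σ_{e={x,y}} ([x ∈ S, y ∉ S] g(x,y) + [y ∈ S, x ∉ S] g(y,x))`.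
[folklore] -/
theorem mt3em_sum_hops_eq_sum_edgeFinset {V : Type*} [Fintype V] [DecidableEq V]
    (G : SimpleGraph V) [DecidableRel G.Adj] {M : Type*} [AddCommMonoid M] (S : Finset V)
    (g : V → V → M) :
    ∑ a ∈ S, ∑ b, (if b ∉ S ∧ G.Adj a b then g a b else 0) =
      ∑ e ∈ G.edgeFinset, Sym2.lift ⟨fun x y => (if x ∈ S ∧ y ∉ S then g x y else 0) +
        (if y ∈ S ∧ x ∉ S then g y x else 0), fun _ _ => add_comm _ _⟩ e := by
  rw [← mt3em_sum_sum_ite_adj G (fun x y => if x ∈ S ∧ y ∉ S then g x y else 0)]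
  symm
  calc ∑ x, ∑ y, (if G.Adj x y then (if x ∈ S ∧ y ∉ S then g x y else 0) else 0)
      = ∑ x ∈ S, ∑ y, (if G.Adj x y then (if x ∈ S ∧ y ∉ S then g x y else 0) else 0) := by
        refine (Finset.sum_subset (Finset.subset_univ S) fun a _ ha => ?_).symm
        exact Finset.sum_eq_zero fun b _ => by simp [ha]
    _ = ∑ a ∈ S, ∑ b, (if b ∉ S ∧ G.Adj a b then g a b else 0) :=
        Finset.sum_congr rfl fun a ha => Finset.sum_congr rfl fun b _ => by
          by_cases hb : b ∈ S <;> by_cases hab : G.Adj a b <;> simp [ha, hb, hab]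

/-! ### The hard-core hopping action in the occupation basis -/

/-- A slide as a transposition: for `x ∈ S`, `y ∉ S`, `(x y) · S = S - x + y`. [folklore] -/
theorem mt3em_map_swap {Λ : Type*} [DecidableEq Λ] {S : Finset Λ} {x y : Λ} (hx : x ∈ S)
    (hy : y ∉ S) : S.map (Equiv.swap x y).toEmbedding = insert y (S.erase x) := by
  ext i
  simp only [Finset.mem_map_equiv, Equiv.symm_swap, Finset.mem_insert, Finset.mem_erase]
  by_cases hiy : i = y
  · subst hiy
    simp [hx]
  · by_cases hix : i = x
    · subst hix
      simp [hy, hiy]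
    · simp [Equiv.swap_apply_of_ne_of_ne hix hiy, hix, hiy]

/-- **The spin-½ XY bond in the occupation basis**: for `x ≠ y`,
`((S¹_xS¹_y + S²_xS²_y + 0·S³_xS³_y) ψ)(1_S) = ½ ([x ∈ S, y ∉ S] ψ(1_{S-x+y}) + [y ∈ S, x ∉ S] ψ(1_{S-y+x}))`:
a bond moves a particle across it, with amplitude `½`. [folklore] -/
theorem mt3em_bond_mulVec_ind {Λ : Type*} [Fintype Λ] [DecidableEq Λ] {x y : Λ} (hxy : x ≠ y)
    (ψ : TensorIndex Λ 2 → ℂ) (S : Finset Λ) :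
    ((spinBond 1 0 x y + spinBond 1 1 x y + ((0 : ℝ) : ℂ) • spinBond 1 2 x y) *ᵥ ψ)
        (fun z => (if z ∈ S then 0 else 1 : Fin 2)) =
      (1 / 2 : ℂ) * ((if x ∈ S ∧ y ∉ S then
          ψ (fun z => if z ∈ insert y (S.erase x) then 0 else 1) else 0) +
        (if y ∈ S ∧ x ∉ S then ψ (fun z => if z ∈ insert x (S.erase y) then 0 else 1) else 0)) := by
  rw [gate_xxzBond_mulVec_apply hxy, gate_swap_ind hxy, Complex.ofReal_zero, zero_mul, zero_mul,
    zero_add]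
  simp only [gate_ind_apply_eq_iff]
  by_cases hx : x ∈ S <;> by_cases hy : y ∈ S
  · simp [hx, hy]
  · rw [mt3em_map_swap hx hy]
    simp [hx, hy]
  · rw [Equiv.swap_comm, mt3em_map_swap hy hx]
    simp [hx, hy]
  · simp [hx, hy]

/-- **The `Δ = 0` XXZ Hamiltonian in the occupation basis** (hard-core hopping on any finite
graph): `(xxzHamiltonian 1 G J 0 ψ)(1_S) = (J/2) Σ_{a ∈ S} Σ_b [b ∉ S, a ∼ b] ψ(1_{S - a + b})`.
[folklore] -/
theorem mt3em_xxzZero_mulVec_ind {Λ : Type*} [Fintype Λ] [DecidableEq Λ] (G : SimpleGraph Λ)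
    [DecidableRel G.Adj] (J : ℝ) (ψ : TensorIndex Λ 2 → ℂ) (S : Finset Λ) :
    (xxzHamiltonian 1 G J 0 *ᵥ ψ) (fun z => (if z ∈ S then 0 else 1 : Fin 2)) =
      ((J / 2 : ℝ) : ℂ) * ∑ a ∈ S, ∑ b, if b ∉ S ∧ G.Adj a b then
        ψ (fun z => if z ∈ insert b (S.erase a) then 0 else 1) else 0 := by
  rw [xxzHamiltonian, Matrix.smul_mulVec, Pi.smul_apply, smul_eq_mul, Matrix.sum_mulVec,
    Finset.sum_apply, mt3em_sum_hops_eq_sum_edgeFinset G S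
      (fun a b => ψ (fun z => if z ∈ insert b (S.erase a) then 0 else 1)),
    Finset.mul_sum, Finset.mul_sum]
  refine Finset.sum_congr rfl fun e he => ?_
  induction e using Sym2.ind with
  | h x y =>
    have hxy : x ≠ y := G.ne_of_adj (by simpa using he)
    simp only [Sym2.lift_mk]
    rw [mt3em_bond_mulVec_ind hxy ψ S]
    push_cast
    ring

/-! ### The stub -/

/-- **STUB 3 · `stub_embedding` — the two-body embedding of an eigenvector** (exact, all `T`, all
`x`): for `Hψ = Eψ`, `H = xyTorus 3 L 1`, the one-particle insertion field
`u(T,x) = [x ∉ T] · Re ψ(1_{T ∪ x})` satisfies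
`-½ Σ_{t ∈ T} Σ_{b ∉ T, b ∼ t} u(T - t + b, x) - ½ Σ_{y ∼ x} u(T, y) - E · u(T, x) = -[x ∈ T] · Σ_{y ∼ x} u(T, y)`.
For `x ∉ T` this is the real part of the eigen-equation at `1_{T ∪ x}` (hard-core hopping,
`mt3em_xxzZero_mulVec_ind`); for `x ∈ T` only the slide of the particle at `x` survives. [folklore] -/
theorem stub_embedding :
    ∀ (L : ℕ) [NeZero L] (E : ℝ) (ψ : TensorIndex (TorusSite 3 L) 2 → ℂ),
      (xyTorus 3 L 1).mulVec ψ = (E : ℂ) • ψ →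
      ∀ (T : Finset (TorusSite 3 L)) (x : TorusSite 3 L),
        -(1 / 2 : ℝ) * (∑ t ∈ T, ∑ b : TorusSite 3 L,
            if b ∉ T ∧ (torusGraph 3 L).Adj t b then
              (if x ∉ insert b (T.erase t) then
                (ψ (fun z => if z ∈ insert x (insert b (T.erase t)) then 0 else 1)).re else 0)
            else 0)
          - (1 / 2 : ℝ) * (∑ y : TorusSite 3 L, if (torusGraph 3 L).Adj x y then
              (if y ∉ T then (ψ (fun z => if z ∈ insert y T then 0 else 1)).re else 0) else 0)
          - E * (if x ∉ T then (ψ (fun z => if z ∈ insert x T then 0 else 1)).re else 0)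
        = -(if x ∈ T then ∑ y : TorusSite 3 L, (if (torusGraph 3 L).Adj x y then
              (if y ∉ T then (ψ (fun z => if z ∈ insert y T then 0 else 1)).re else 0) else 0)
            else 0) := by
  intro L _ E ψ hH T x
  by_cases hx : x ∈ T
  · -- `x ∈ T`: `u(T, x) = 0`; in the first term only the slide of the particle at `x` survives
    rw [if_pos hx, if_neg (not_not.mpr hx), mul_zero, sub_zero]
    have hA : (∑ t ∈ T, ∑ b : TorusSite 3 L, if b ∉ T ∧ (torusGraph 3 L).Adj t b then
          (if x ∉ insert b (T.erase t) then
            (ψ (fun z => if z ∈ insert x (insert b (T.erase t)) then 0 else 1)).re else 0) else 0) =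
        ∑ y : TorusSite 3 L, if (torusGraph 3 L).Adj x y then
          (if y ∉ T then (ψ (fun z => if z ∈ insert y T then 0 else 1)).re else 0) else 0 := by
      rw [← Finset.add_sum_erase T _ hx, Finset.sum_eq_zero (s := T.erase x) ?_, add_zero]
      · refine Finset.sum_congr rfl fun b _ => ?_
        by_cases hb : b ∈ T
        · simp [hb]
        · by_cases hadj : (torusGraph 3 L).Adj x b
          · have hbx : b ≠ x := fun h => hb (h ▸ hx)
            have h1 : x ∉ insert b (T.erase x) := by simp [Ne.symm hbx]
            have h2 : insert x (insert b (T.erase x)) = insert b T := by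
              rw [Finset.insert_comm, Finset.insert_erase hx]
            rw [if_pos (And.intro hb hadj), if_pos h1, h2, if_pos hadj, if_pos hb]
          · simp [hadj]
      · intro t ht
        have hxt : x ∈ T.erase t := Finset.mem_erase.mpr ⟨(Finset.ne_of_mem_erase ht).symm, hx⟩
        refine Finset.sum_eq_zero fun b _ => ?_
        have hxin : x ∈ insert b (T.erase t) := Finset.mem_insert_of_mem hxt
        simp [hxin]
    rw [hA]
    ring
  · -- `x ∉ T`: the real part of the eigen-equation read at `S = T ∪ {x}`
    rw [if_neg hx, if_pos hx, neg_zero]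
    have hB : (∑ b : TorusSite 3 L, if b ∉ insert x T ∧ (torusGraph 3 L).Adj x b then
          ψ (fun z => if z ∈ insert b T then 0 else 1) else 0) =
        ∑ y : TorusSite 3 L, if (torusGraph 3 L).Adj x y then
          (if y ∉ T then ψ (fun z => if z ∈ insert y T then 0 else 1) else 0) else 0 := by
      refine Finset.sum_congr rfl fun b _ => ?_
      by_cases hadj : (torusGraph 3 L).Adj x b
      · have hbx : b ≠ x := hadj.ne.symm
        by_cases hb : b ∈ T <;> simp [hadj, hb, hbx]
      · simp [hadj]
    have hA : (∑ t ∈ T, ∑ b : TorusSite 3 L, if b ∉ insert x T ∧ (torusGraph 3 L).Adj t b then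
          ψ (fun z => if z ∈ insert b ((insert x T).erase t) then 0 else 1) else 0) =
        ∑ t ∈ T, ∑ b : TorusSite 3 L, if b ∉ T ∧ (torusGraph 3 L).Adj t b then
          (if x ∉ insert b (T.erase t) then
            ψ (fun z => if z ∈ insert x (insert b (T.erase t)) then 0 else 1) else 0) else 0 := by
      refine Finset.sum_congr rfl fun t ht => Finset.sum_congr rfl fun b _ => ?_
      have hxt : x ≠ t := fun h => hx (h ▸ ht)
      by_cases hbT : b ∈ T
      · simp [hbT]
      · by_cases hadj : (torusGraph 3 L).Adj t b
        · by_cases hbx : b = x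
          · simp [hbx]
          · have c1 : b ∉ insert x T ∧ (torusGraph 3 L).Adj t b := ⟨by simp [hbx, hbT], hadj⟩
            have h1 : x ∉ insert b (T.erase t) := by simp [Ne.symm hbx, hx]
            have h2 : insert b ((insert x T).erase t) = insert x (insert b (T.erase t)) := by
              rw [Finset.erase_insert_of_ne hxt, Finset.insert_comm]
            rw [if_pos c1, if_pos (And.intro hbT hadj), if_pos h1, h2]
        · simp [hadj]
    have heig := congrFun hH (fun z => (if z ∈ insert x T then 0 else 1 : Fin 2))
    rw [Pi.smul_apply, smul_eq_mul, xyTorus, mt3em_xxzZero_mulVec_ind, Finset.sum_insert hx,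
      Finset.erase_insert hx, hB, hA] at heig
    have hre := congrArg Complex.re heig
    simp only [Complex.re_ofReal_mul, Complex.add_re, Complex.re_sum, apply_ite Complex.re,
      Complex.zero_re] at hre
    linear_combination hre

end Summit.AtomisticToContinuum.BoseEinsteinCondensation.Cruxes.InsertionFieldDelocalisation.MobileTrapDirichletEigenfunction

end
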